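import Literature.MathematicalPhysics.QuantumFieldTheory.Balaban1983to89.Node00.TorusCoverPropSixGauge

/-!
# NODE 00 — THE TORUS→`ℤᵈ` TWIN, FILE 4a′: [6] PROPOSITION 6's CONCLUSION (1.135)–(1.136) AT NODE 00's `ℤᵈ` MEMBER READ AS AN `SU(N)` GAUGE WITH **THREE** LETTERS —
# FILE 28a's `|A|`, `|∇^ηA|` AND PRINT'S SECOND-ORDER LETTER `|∂^{η*}∂^ηA|` ([15] Thm 1 (10) ∕ [6] (1.136)₃), pointwise on the box `□`

Cell `pub-ymgap`, seat `pub-ymgap-dag-n07-e` generation 13 (R141 (C), DAG node N07 = [15]; cell INBOX INTENT-34 of 2026-08-27).  NEW leaf, PROOF kind (no `def`); this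
seat's FILE 28a `Node00.TorusCoverPropSixGauge` (`sideTouches_sq_top_of_mem_box`, `mlogCfg_eq_logCfg_of_mem_box`, `norm_mlogCfg_le_of_sides`, `norm_sub_le_of_msup_grad`),
FILE 3b `Node00.TorusCoverSUGauge` (`exists_suGauge_of_unitaryGauge`, `traceless`, `norm_traceless_le`, `norm_traceless_sub_le`, `traceless_sub`), node00-def-cube's
`Node00.CarriersB8Cube` (`GaugedBoundB8`, `CubeB8`), lit-balaban's `B8ScaledSupNorm` (`bondNorm`, `msup`, `Bdd`, `norm_le_of_msup_le`), `B8Eq143PlaqExpansion.pdiv`,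
`B8Eq146AExpansion.plaqCovDeriv`, `B8Ineq132.covDeriv` CONSUMED BY NAME, nothing modified.  `--supports stmt-QuantumFields-20541` (K0⁷).  Companions (same INTENT): 34b
`Node00.TorusCoverLocalGauge10` (the push-down to one grid cube of the torus with the third letter) and 34c `Node00.TorusCoverGaugeTokensR10` (the (152)-token carrying
the (10)-letter, from `B8.Prop6Printed … zdCub` BY NAME).  [6] = [Balaban1985RegularSpaces]; [15] = [Balaban1985Variational]; B9 = [Balaban1985BackgroundPropagators].

WHY.  The K0 road's (152)∕(9) step tokens (FILE 29 `Gauge152OfClassTopStepR`, `Gauge9RegSepTopStepR`) carry `|A|, |∇A|` only, because FILE 28a extracted only the members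
(1.136)₁∕(1.136)₂ of [6] Proposition 6's conclusion.  But N05's member sentence at node00-def-cube's `zdCub` EXPORTS the second-order members too: `Node00.GaugedBoundB8`'s
ninth conjunct is `bondNorm L k η (−3) □• (fun x μ => pdiv η 1 (plaqCovDeriv η 1 Ã) μ x) ≤ r` — print's «(Lʲη)³|∂^{η*}∂^ηA| ≤ 7dL²B₁Mα₀ on □_j» (1.136)₃ = [15] (152)'s third
letter = [15] Thm 1 (10)'s first member.  Modules 33b∕33c (`Sect2.LocalGauge10On`, `coDivSmallOn_of_localGauge10On`) consume exactly this letter on the torus.  This file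
does the `ℤᵈ`-side extraction: the p. 86 scaled supremum read pointwise in the box (its boundedness side condition from the masked exponent), the unmasking on bonds whose
whole second-order stencil lies in the box (locality of the operator), and the passage through FILE 3b's traceless `SU(N)` correction (the operator is `ℝ`-linear).

CONTENTS.  §1 (any normed ℂ-algebra, trivial background) `covDeriv_one_apply`, `plaqCovDeriv_one_apply`, `plaqCovDeriv_one_swap`, `norm_plaqCovDeriv_one_le`, `norm_pdiv_one_le`,
★ `pdiv_plaqCovDeriv_one_congr` (locality).  §2 (a cube datum `c`, C⋆-algebra `𝔸`) `bdd_codiffFamily_of_sides`, `bondTouches_sq_top_of_mem_box`, ★ `norm_codiff_mlogCfg_le`,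
★ `norm_codiff_logCfg_le`.  §3 (`M_N(ℂ)`) `traceless_add`, `traceless_smul_real`, `traceless_sub'`, ★ `pdiv_plaqCovDeriv_one_traceless`.  §4 ★★ `exists_suGauge_letters10_of_gaugedBoundB8`.

HONEST FRAMING: bookkeeping (finite sums, the p. 86 weighted supremum read pointwise, linearity) around the HYPOTHESIS `GaugedBoundB8` (Prop. 6's conclusion at the member —
N05's node, never asserted here); nothing of Bałaban discharged; K0⁷ ∕ V15 stub 1 NOT closed; N07 ∕ N05 NOT discharged; counts unmoved (5∕27); one finite T⁴ programme at
fixed ε — NOT continuum ∕ ℝ⁴ ∕ infinite volume ∕ OS ∕ mass gap ∕ Clay.  No `sorry`, no `def`, no `instance`, no `notation`.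
-/

noncomputable section

namespace Literature.MathematicalPhysics.QuantumFieldTheory.Balaban1983to89.Node00

open scoped Matrix.Norms.L2Operator
open Complex (I)
open B7Prop1Explicit (e e_apply)
open B7Prop1Local (InBox AgreeOn)
open B7Prop2Explicit (unitaryUnits mem_unitaryUnits)
open B7Prop2SpecialUnitary (specialUnitaryUnits mem_specialUnitaryUnits)
open B7Eq78Linearization (conjR conjR_apply)
open B8Ineq130 (tlo thi)
open B8Ineq132 (covDerivFwd covDeriv BondTouches)
open B8Eq131Cubes (box cube tcube tLo tHi bLo bHi box_subset_cube_top)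
open B8Eq131CubesAdmissible (cubeFam cubeFam_of_pos)
open B8Eq140Level (SideTouches sideTouches_of_bondTouches)
open B8Eq138LandauZd (logCfg)
open B8Eq184Proof (cfgExp)
open B8LeafModelZd3 (mlogCfg mlogCfg_of_sideTouches mlogCfg_of_not)
open B8ScaledSupNorm (msup Bdd weight norm_le_of_msup_le bondNorm)
open B8Eq146AExpansion (plaqCovDeriv plaqCovDeriv_eq_covDerivFwd)
open B8Eq143PlaqExpansion (pdiv)

variable {d N : ℕ} [NeZero N]

/-! ## §1  Closed forms of `covDeriv`, `plaqCovDeriv`, `pdiv` at the trivial background; size and locality -/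

section ClosedForms

variable {𝔸 : Type*} [NormedRing 𝔸] [NormedAlgebra ℂ 𝔸]

/-- [6] (1.1), second line, AT THE TRIVIAL BACKGROUND: `(D^{η*}_{1,ν}G)(x) = η⁻¹(G(x − e_ν) − G(x))` (lit-balaban's `covDeriv` with `R(1) = id`).
[cite: Balaban1985RegularSpaces, (1.1) p.76] -/
theorem covDeriv_one_apply (η : ℝ) (ν : Fin d) (G : B7Prop1Explicit.Site d → 𝔸) (x : B7Prop1Explicit.Site d) :
    covDeriv η (1 : B7Prop1Explicit.Site d → Fin d → 𝔸ˣ) ν G x = η⁻¹ • (G (x - e ν) - G x) := by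
  simp only [covDeriv, Pi.one_apply, inv_one, conjR_apply, Units.val_one, one_mul, mul_one]

/-- B9 (3.4) AT THE TRIVIAL BACKGROUND: `(∂^ηA)(p_{μν}(x)) = η⁻¹(A_ν(x+e_μ) − A_ν(x)) − η⁻¹(A_μ(x+e_ν) − A_μ(x))` (lit-balaban's `plaqCovDeriv η 1` via
`plaqCovDeriv_eq_covDerivFwd`). [cite: Balaban1985BackgroundPropagators, (3.4) p.391; Balaban1985RegularSpaces, (1.1) p.76] -/
theorem plaqCovDeriv_one_apply (η : ℝ) (A : B7Prop1Explicit.Site d → Fin d → 𝔸) (μ ν : Fin d) (x : B7Prop1Explicit.Site d) :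
    plaqCovDeriv η (1 : B7Prop1Explicit.Site d → Fin d → 𝔸ˣ) A μ ν x =
      η⁻¹ • (A (x + e μ) ν - A x ν) - η⁻¹ • (A (x + e ν) μ - A x μ) := by
  rw [plaqCovDeriv_eq_covDerivFwd]
  simp only [covDerivFwd, Pi.one_apply, conjR_apply, Units.val_one, inv_one, one_mul, mul_one]

/-- Antisymmetry `(∂^ηA)(p_{νμ}) = −(∂^ηA)(p_{μν})` at the trivial background ([6] (1.2) «F_{μν} = −F_{νμ}»). [cite: Balaban1985RegularSpaces, (1.2) p.76 (bookkeeping)] -/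
theorem plaqCovDeriv_one_swap (η : ℝ) (A : B7Prop1Explicit.Site d → Fin d → 𝔸) (μ ν : Fin d) (x : B7Prop1Explicit.Site d) :
    plaqCovDeriv η (1 : B7Prop1Explicit.Site d → Fin d → 𝔸ˣ) A ν μ x = -plaqCovDeriv η (1 : B7Prop1Explicit.Site d → Fin d → 𝔸ˣ) A μ ν x := by
  rw [plaqCovDeriv_one_apply, plaqCovDeriv_one_apply]; abel

/-- The curl of a bounded potential: `‖A‖ ≤ m` everywhere ⇒ `‖(∂^ηA)(p)‖ ≤ η⁻¹·4m` (crude, for the boundedness side condition of the p. 86 norm).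
[cite: Balaban1985RegularSpaces, p.86 (definition after (1.55)); Balaban1985BackgroundPropagators, (3.4) p.391 (bookkeeping)] -/
theorem norm_plaqCovDeriv_one_le {η m : ℝ} (hη : 0 < η) {A : B7Prop1Explicit.Site d → Fin d → 𝔸} (hA : ∀ y κ, ‖A y κ‖ ≤ m)
    (μ ν : Fin d) (x : B7Prop1Explicit.Site d) :
    ‖plaqCovDeriv η (1 : B7Prop1Explicit.Site d → Fin d → 𝔸ˣ) A μ ν x‖ ≤ η⁻¹ * (4 * m) := by
  rw [plaqCovDeriv_one_apply, ← smul_sub, norm_smul, Real.norm_eq_abs, abs_of_pos (inv_pos.2 hη)]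
  refine mul_le_mul_of_nonneg_left ?_ (inv_nonneg.2 hη.le)
  calc ‖A (x + e μ) ν - A x ν - (A (x + e ν) μ - A x μ)‖
      ≤ (‖A (x + e μ) ν‖ + ‖A x ν‖) + (‖A (x + e ν) μ‖ + ‖A x μ‖) :=
        (norm_sub_le _ _).trans (add_le_add (norm_sub_le _ _) (norm_sub_le _ _))
    _ ≤ (m + m) + (m + m) := by gcongr <;> exact hA _ _
    _ = 4 * m := by ring

/-- The co-differential of a bounded plaquette function at the trivial background: `‖F‖ ≤ q` ⇒ `‖(D^{η*}_1F)_μ(x)‖ ≤ 2d·η⁻¹·2q` (crude; the boundedness side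
condition of the p. 86 norm). [cite: Balaban1985RegularSpaces, (1.2) p.76, p.86 (definition after (1.55)) (bookkeeping)] -/
theorem norm_pdiv_one_le {η q : ℝ} (hη : 0 < η) {F : Fin d → Fin d → B7Prop1Explicit.Site d → 𝔸} (hF : ∀ a b y, ‖F a b y‖ ≤ q)
    (μ : Fin d) (x : B7Prop1Explicit.Site d) :
    ‖pdiv η (1 : B7Prop1Explicit.Site d → Fin d → 𝔸ˣ) F μ x‖ ≤ 2 * d * (η⁻¹ * (2 * q)) := by
  have hterm : ∀ ν a b, ‖covDeriv η (1 : B7Prop1Explicit.Site d → Fin d → 𝔸ˣ) ν (F a b) x‖ ≤ η⁻¹ * (2 * q) := by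
    intro ν a b
    rw [covDeriv_one_apply, norm_smul, Real.norm_eq_abs, abs_of_pos (inv_pos.2 hη)]
    refine mul_le_mul_of_nonneg_left ((norm_sub_le _ _).trans ?_) (inv_nonneg.2 hη.le)
    linarith [hF a b (x - e ν), hF a b x]
  have hq : 0 ≤ η⁻¹ * (2 * q) := le_trans (norm_nonneg _) (hterm μ μ μ)
  have h1 : ‖∑ ν ∈ Finset.Iio μ, covDeriv η (1 : B7Prop1Explicit.Site d → Fin d → 𝔸ˣ) ν (F ν μ) x‖ ≤ d * (η⁻¹ * (2 * q)) := by
    refine (norm_sum_le _ _).trans ((Finset.sum_le_sum fun ν _ => hterm ν ν μ).trans ?_)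
    rw [Finset.sum_const, nsmul_eq_mul]
    exact mul_le_mul_of_nonneg_right (by exact_mod_cast (Finset.card_le_univ _).trans_eq (Finset.card_fin d)) hq
  have h2 : ‖∑ ν ∈ Finset.Ioi μ, covDeriv η (1 : B7Prop1Explicit.Site d → Fin d → 𝔸ˣ) ν (F μ ν) x‖ ≤ d * (η⁻¹ * (2 * q)) := by
    refine (norm_sum_le _ _).trans ((Finset.sum_le_sum fun ν _ => hterm ν μ ν).trans ?_)
    rw [Finset.sum_const, nsmul_eq_mul]
    exact mul_le_mul_of_nonneg_right (by exact_mod_cast (Finset.card_le_univ _).trans_eq (Finset.card_fin d)) hq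
  unfold pdiv
  refine (norm_sub_le _ _).trans ?_
  linarith

/-- **LOCALITY of `∂^{η*}∂^ηA` at the trivial background**: `(D^{η*}_1 D^η_1 A)(x, x+e_μ)` reads the potential only on the bonds based at `x`, `x ± e_ν`, `x + e_μ`,
`x − e_ν + e_μ`; two potentials agreeing there have the same value. [cite: Balaban1985RegularSpaces, (1.1)–(1.2) p.76 (bookkeeping)] -/
theorem pdiv_plaqCovDeriv_one_congr (η : ℝ) {A A' : B7Prop1Explicit.Site d → Fin d → 𝔸} {x : B7Prop1Explicit.Site d} {μ : Fin d}
    (h0 : ∀ κ, A x κ = A' x κ) (hμ : ∀ κ, A (x + e μ) κ = A' (x + e μ) κ)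
    (hν : ∀ ν κ, A (x + e ν) κ = A' (x + e ν) κ ∧ A (x - e ν) κ = A' (x - e ν) κ ∧ A (x - e ν + e μ) κ = A' (x - e ν + e μ) κ) :
    pdiv η (1 : B7Prop1Explicit.Site d → Fin d → 𝔸ˣ) (plaqCovDeriv η 1 A) μ x =
      pdiv η (1 : B7Prop1Explicit.Site d → Fin d → 𝔸ˣ) (plaqCovDeriv η 1 A') μ x := by
  have hplaq : ∀ ν, plaqCovDeriv η (1 : B7Prop1Explicit.Site d → Fin d → 𝔸ˣ) A ν μ x = plaqCovDeriv η 1 A' ν μ x ∧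
      plaqCovDeriv η (1 : B7Prop1Explicit.Site d → Fin d → 𝔸ˣ) A ν μ (x - e ν) = plaqCovDeriv η 1 A' ν μ (x - e ν) := by
    intro ν
    refine ⟨?_, ?_⟩
    · rw [plaqCovDeriv_one_apply, plaqCovDeriv_one_apply, (hν ν μ).1, h0 μ, hμ ν, h0 ν]
    · rw [plaqCovDeriv_one_apply, plaqCovDeriv_one_apply, sub_add_cancel, h0 μ, (hν ν μ).2.1, (hν ν ν).2.2, (hν ν ν).2.1]
  unfold pdiv
  congr 1
  · refine Finset.sum_congr rfl fun ν _ => ?_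
    rw [covDeriv_one_apply, covDeriv_one_apply, (hplaq ν).1, (hplaq ν).2]
  · refine Finset.sum_congr rfl fun ν _ => ?_
    rw [covDeriv_one_apply, covDeriv_one_apply, plaqCovDeriv_one_swap η A ν μ (x - e ν), plaqCovDeriv_one_swap η A ν μ x,
      plaqCovDeriv_one_swap η A' ν μ (x - e ν), plaqCovDeriv_one_swap η A' ν μ x, (hplaq ν).1, (hplaq ν).2]

end ClosedForms

/-! ## §2  The (1.136)₃ family of the masked exponent is bounded; `|∂^{η*}∂^ηA|_(−3) ≤ r` read pointwise inside `□` -/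

section Letters

variable {L K : ℕ} {Ω : ℕ → Set (B7Prop1Explicit.Site d)} (c : CubeB8 d L K Ω)
variable {𝔸 : Type*} [CStarAlgebra 𝔸]

/-- **THE (1.136)₃ FAMILY IS BOUNDED** (`B8ScaledSupNorm.Bdd`): the weights `(Lʲη)³`, `j ≤ k`, are at most `(Lᵏη)³` and `∂^{η*}∂^η` of the masked exponent (bounded by
`rη⁻¹` everywhere, FILE 28a `norm_mlogCfg_le_of_sides`) is bounded by `2d·η⁻¹·2·(η⁻¹·4·rη⁻¹)` — the side condition under which the p. 86 supremum `|·|_(−3)` reads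
pointwise. [cite: Balaban1985RegularSpaces, Prop. 6 (1.136) p.99, p.86 (the scaled sup norm)] -/
theorem bdd_codiffFamily_of_sides (hL : 1 ≤ L) {η r : ℝ} (hη : 0 < η) (hr : 0 ≤ r) (U₁ : B7Prop1Explicit.Site d → Fin d → 𝔸ˣ)
    (h136 : ∀ j, j ≤ c.k → ∀ b ∈ {b : B7Prop1Explicit.Site d × Fin d | SideTouches (c.sq j) b.1 b.2}, ‖logCfg η U₁ b.1 b.2‖ ≤ r * ((L : ℝ) ^ j * η)⁻¹) :
    Bdd L c.k η (-(3 : ℝ)) (fun j (b : B7Prop1Explicit.Site d × Fin d) => BondTouches (c.sq j) b.1 b.2)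
      (fun b => pdiv η (1 : B7Prop1Explicit.Site d → Fin d → 𝔸ˣ) (plaqCovDeriv η 1 (mlogCfg c.k η c.sq U₁)) b.2 b.1) := by
  refine ⟨((L : ℝ) ^ c.k * η) ^ (3 : ℝ) * (2 * d * (η⁻¹ * (2 * (η⁻¹ * (4 * (r * η⁻¹)))))), fun j hj b _ => ?_⟩
  have hscale : 0 < (L : ℝ) ^ j * η := B8ScaledSupNorm.scale_pos hL hη j
  have hw : weight L η (-(3 : ℝ)) j ≤ ((L : ℝ) ^ c.k * η) ^ (3 : ℝ) := by
    rw [weight, neg_neg]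
    exact Real.rpow_le_rpow hscale.le (mul_le_mul_of_nonneg_right (pow_le_pow_right₀ (by exact_mod_cast hL) hj) hη.le) (by norm_num)
  have hm : ∀ y κ, ‖mlogCfg c.k η c.sq U₁ y κ‖ ≤ r * η⁻¹ := norm_mlogCfg_le_of_sides c hL hη hr U₁ h136
  have hF := norm_pdiv_one_le hη (fun a b y => norm_plaqCovDeriv_one_le hη hm a b y) b.2 b.1
  exact mul_le_mul hw hF (norm_nonneg _) (by positivity)

/-- **A bond based in `□` touches `□_k`** (`□ ⊂ □_k`, [6] (1.131) «□_{k+1} = □»; p. 77's bond convention «at least one end-point»). [cite: Balaban1985RegularSpaces, (1.131) p.99, p.77 (convention before (1.5))] -/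
theorem bondTouches_sq_top_of_mem_box {x : B7Prop1Explicit.Site d} (hx : x ∈ box L c.a c.M c.k) (μ : Fin d) : BondTouches (c.sq c.k) x μ := by
  have hsq : c.sq c.k = cube L c.a c.M c.ρ c.k c.k := cubeFam_of_pos false L c.a c.M c.ρ c.one_le_k le_rfl
  rw [hsq]
  exact Or.inl (box_subset_cube_top L c.a c.M c.ρ c.k hx)

/-- **`|∂^{η*}∂^ηA|_(−3) ≤ r` READ POINTWISE INSIDE `□`, masked exponent**: for `x ∈ □`, `‖(∂^{η*}∂^ηÃ)(x, x+e_μ)‖ ≤ r·((Lᵏη)³)⁻¹` (`Ã = mlogCfg …`, the (1.136)₃ member of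
`Node00.GaugedBoundB8`). [cite: Balaban1985RegularSpaces, Prop. 6 (1.136) p.99 («(Lʲη)³|∂^{η*}∂^η A| ≤ …»), p.86] -/
theorem norm_codiff_mlogCfg_le (hL : 1 ≤ L) {η r : ℝ} (hη : 0 < η) (hr : 0 ≤ r) (U₁ : B7Prop1Explicit.Site d → Fin d → 𝔸ˣ)
    (h136 : ∀ j, j ≤ c.k → ∀ b ∈ {b : B7Prop1Explicit.Site d × Fin d | SideTouches (c.sq j) b.1 b.2}, ‖logCfg η U₁ b.1 b.2‖ ≤ r * ((L : ℝ) ^ j * η)⁻¹)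
    (hcod : bondNorm L c.k η (-(3 : ℝ)) c.sq
        (fun x μ => pdiv η (1 : B7Prop1Explicit.Site d → Fin d → 𝔸ˣ) (plaqCovDeriv η 1 (mlogCfg c.k η c.sq U₁)) μ x) ≤ r)
    {x : B7Prop1Explicit.Site d} (hx : x ∈ box L c.a c.M c.k) (μ : Fin d) :
    ‖pdiv η (1 : B7Prop1Explicit.Site d → Fin d → 𝔸ˣ) (plaqCovDeriv η 1 (mlogCfg c.k η c.sq U₁)) μ x‖ ≤ r * (((L : ℝ) ^ c.k * η) ^ 3)⁻¹ := by
  have h := norm_le_of_msup_le (F := fun b : B7Prop1Explicit.Site d × Fin d =>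
      pdiv η (1 : B7Prop1Explicit.Site d → Fin d → 𝔸ˣ) (plaqCovDeriv η 1 (mlogCfg c.k η c.sq U₁)) b.2 b.1)
    (mem := fun j (b : B7Prop1Explicit.Site d × Fin d) => BondTouches (c.sq j) b.1 b.2)
    hL hη (bdd_codiffFamily_of_sides c hL hη hr U₁ h136) hcod le_rfl (i := (x, μ)) (bondTouches_sq_top_of_mem_box c hx μ)
  have hscale : 0 < (L : ℝ) ^ c.k * η := B8ScaledSupNorm.scale_pos hL hη c.k
  have hrpow : ((L : ℝ) ^ c.k * η) ^ (-(3 : ℝ)) = (((L : ℝ) ^ c.k * η) ^ 3)⁻¹ := by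
    rw [Real.rpow_neg hscale.le, show (3 : ℝ) = ((3 : ℕ) : ℝ) by norm_num, Real.rpow_natCast]
  rw [hrpow] at h
  exact h

/-- **`|∂^{η*}∂^ηA|_(−3) ≤ r` READ POINTWISE INSIDE `□`, unmasked exponent `A = (1∕iη) log U₁`**: if the whole stencil of the bond `⟨x, x+e_μ⟩` (`x`, `x+e_μ`, `x ± e_ν`,
`x − e_ν + e_μ`) lies in `□`, the masked exponent is the logarithm on every bond read (FILE 28a `mlogCfg_eq_logCfg_of_mem_box`) and `‖(∂^{η*}∂^ηA)(x, x+e_μ)‖ ≤ r·((Lᵏη)³)⁻¹`.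
[cite: Balaban1985RegularSpaces, Prop. 6 (1.135)–(1.136) p.99] -/
theorem norm_codiff_logCfg_le (hd : 2 ≤ d) (hL : 1 ≤ L) {η r : ℝ} (hη : 0 < η) (hr : 0 ≤ r) (U₁ : B7Prop1Explicit.Site d → Fin d → 𝔸ˣ)
    (h136 : ∀ j, j ≤ c.k → ∀ b ∈ {b : B7Prop1Explicit.Site d × Fin d | SideTouches (c.sq j) b.1 b.2}, ‖logCfg η U₁ b.1 b.2‖ ≤ r * ((L : ℝ) ^ j * η)⁻¹)
    (hcod : bondNorm L c.k η (-(3 : ℝ)) c.sq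
        (fun x μ => pdiv η (1 : B7Prop1Explicit.Site d → Fin d → 𝔸ˣ) (plaqCovDeriv η 1 (mlogCfg c.k η c.sq U₁)) μ x) ≤ r)
    {x : B7Prop1Explicit.Site d} {μ : Fin d} (hx : x ∈ box L c.a c.M c.k) (hxμ : x + e μ ∈ box L c.a c.M c.k)
    (hν : ∀ ν, x + e ν ∈ box L c.a c.M c.k ∧ x - e ν ∈ box L c.a c.M c.k ∧ x - e ν + e μ ∈ box L c.a c.M c.k) :
    ‖pdiv η (1 : B7Prop1Explicit.Site d → Fin d → 𝔸ˣ) (plaqCovDeriv η 1 (logCfg η U₁)) μ x‖ ≤ r * (((L : ℝ) ^ c.k * η) ^ 3)⁻¹ := by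
  have heq := pdiv_plaqCovDeriv_one_congr η (A := mlogCfg c.k η c.sq U₁) (A' := logCfg η U₁) (x := x) (μ := μ)
    (fun κ => mlogCfg_eq_logCfg_of_mem_box c hd η U₁ hx κ) (fun κ => mlogCfg_eq_logCfg_of_mem_box c hd η U₁ hxμ κ)
    (fun ν κ => ⟨mlogCfg_eq_logCfg_of_mem_box c hd η U₁ (hν ν).1 κ, mlogCfg_eq_logCfg_of_mem_box c hd η U₁ (hν ν).2.1 κ,
      mlogCfg_eq_logCfg_of_mem_box c hd η U₁ (hν ν).2.2 κ⟩)
  rw [← heq]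
  exact norm_codiff_mlogCfg_le c hL hη hr U₁ h136 hcod hx μ

end Letters

/-! ## §3  The traceless `SU(N)` correction commutes with `∂^{η*}∂^η` -/

section Traceless

omit [NeZero N] in
/-- The traceless part is additive. [cite: Balaban1985Averaging, (20) p.21 (bookkeeping)] -/
theorem traceless_add (X Y : MatA N) : traceless (X + Y) = traceless X + traceless Y := by
  simp only [traceless, Matrix.trace_add, Complex.add_re, add_div, Complex.ofReal_add, add_smul]
  abel

omit [NeZero N] in
/-- The traceless part is `ℝ`-homogeneous (`Re tr (rX) = r·Re tr X`). [cite: Balaban1985Averaging, (20) p.21 (bookkeeping)] -/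
theorem traceless_smul_real (r : ℝ) (X : MatA N) : traceless (r • X) = r • traceless X := by
  rw [traceless, traceless, smul_sub, Matrix.trace_smul, Complex.smul_re, smul_eq_mul, mul_div_assoc, Complex.ofReal_mul, mul_smul,
    Complex.coe_smul]

omit [NeZero N] in
/-- The traceless part of a difference (FILE 3b's `traceless_sub`, reversed). [cite: Balaban1985Averaging, (20) p.21 (bookkeeping)] -/
theorem traceless_sub' (X Y : MatA N) : traceless (X - Y) = traceless X - traceless Y := (traceless_sub X Y).symm

omit [NeZero N] in
/-- **THE TRACELESS CORRECTION COMMUTES WITH `∂^{η*}∂^η` AT THE TRIVIAL BACKGROUND** (the operator is `ℝ`-linear in the potential): FILE 3b's `SU(N)` normalisation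
`A ↦ A − (Re tr A∕N)·1` costs the (10)-letter the same factor `2` as the other letters (`norm_traceless_le`). [cite: Balaban1985RegularSpaces, (1.2) p.76, (1.36) p.82 (bookkeeping); Balaban1985Averaging, (20) p.21] -/
theorem pdiv_plaqCovDeriv_one_traceless (η : ℝ) (A : B7Prop1Explicit.Site d → Fin d → MatA N) (μ : Fin d) (x : B7Prop1Explicit.Site d) :
    pdiv η (1 : B7Prop1Explicit.Site d → Fin d → (MatA N)ˣ) (plaqCovDeriv η 1 (fun y κ => traceless (A y κ))) μ x =
      traceless (pdiv η (1 : B7Prop1Explicit.Site d → Fin d → (MatA N)ˣ) (plaqCovDeriv η 1 A) μ x) := by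
  set T : MatA N →+ MatA N := AddMonoidHom.mk' (traceless (N := N)) traceless_add with hT
  have hTs : ∀ (r : ℝ) (X : MatA N), T (r • X) = r • T X := fun r X => traceless_smul_real r X
  have hplaq : ∀ a b y, plaqCovDeriv η (1 : B7Prop1Explicit.Site d → Fin d → (MatA N)ˣ) (fun y κ => traceless (A y κ)) a b y =
      T (plaqCovDeriv η (1 : B7Prop1Explicit.Site d → Fin d → (MatA N)ˣ) A a b y) := by
    intro a b y
    rw [plaqCovDeriv_one_apply, plaqCovDeriv_one_apply, map_sub, hTs, hTs, map_sub, map_sub]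
    rfl
  have hcov : ∀ ν (G : B7Prop1Explicit.Site d → MatA N),
      covDeriv η (1 : B7Prop1Explicit.Site d → Fin d → (MatA N)ˣ) ν (fun y => T (G y)) x = T (covDeriv η (1 : B7Prop1Explicit.Site d → Fin d → (MatA N)ˣ) ν G x) := by
    intro ν G
    rw [covDeriv_one_apply, covDeriv_one_apply, hTs, map_sub]
  show _ = T _
  unfold pdiv
  rw [map_sub, map_sum, map_sum]
  congr 1
  · refine Finset.sum_congr rfl fun ν _ => ?_
    rw [← hcov]
    congr 1
    funext y
    exact hplaq ν μ y
  · refine Finset.sum_congr rfl fun ν _ => ?_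
    rw [← hcov]
    congr 1
    funext y
    exact hplaq μ ν y

end Traceless

/-! ## §4  ★★ The `SU(N)` gauge with THREE letters from `GaugedBoundB8` -/

section Assembly

variable {L K : ℕ} {Ω : ℕ → Set (B7Prop1Explicit.Site d)}

/-- ★★ **[6] PROPOSITION 6's CONCLUSION READ AS AN `SU(N)` GAUGE WITH THREE LETTERS ON `□`** — FILE 28a's ★★★ `exists_suGauge_letters_of_gaugedBoundB8` WITH PRINT'S
SECOND-ORDER LETTER (1.136)₃ ∕ [15] (10) ADDED.  Let `V` be `SU(N)`-valued on `ℤᵈ`, `c` a cube datum, `L ≥ 2`, `d ≥ 2`, `η > 0`, `r ≥ 0`, `Node00.GaugedBoundB8 L η V c r`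
((1.135)–(1.138) with the number `r`) and the `2π`-window `(2W + 1)·ηN·r(Lᵏη)⁻¹ < 2π`.  Then there are an `SU(N)`-valued gauge `s` and an exponent `Ã` (the traceless
part of (1.136)'s `A`) with `V^{ιSU ∘ s}(x, x+e_μ) = e^{iηÃ(x,μ)}` on the bonds of `□ = box L a M k`, `‖Ã(x, μ)‖ ≤ 2r(Lᵏη)⁻¹` there, `‖Ã(x+e_μ, ν) − Ã(x, ν)‖ ≤ 2ηr((Lᵏη)²)⁻¹`
on its derivative triples, AND `‖(∂^{η*}∂^ηÃ)(x, x+e_μ)‖ ≤ 2r((Lᵏη)³)⁻¹` (lit-balaban's `pdiv η 1 (plaqCovDeriv η 1 Ã) μ x`) whenever the bond's stencil `x`, `x+e_μ`, `x ± e_ν`,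
`x − e_ν + e_μ` lies in `□`.  The Laplacian member (1.136)₄ is available the same way (not extracted here).
[cite: Balaban1985RegularSpaces, Prop. 6 (1.135)–(1.136) p.99, Thm 2 (1.36) pp.82–83; Balaban1985Variational, Thm 1 (9)–(10) p.279, (152) p.301] -/
theorem exists_suGauge_letters10_of_gaugedBoundB8 (hd : 2 ≤ d) (hL : 2 ≤ L) (c : CubeB8 d L K Ω)
    (V : B7Prop1Explicit.Site d → Fin d → (MatA N)ˣ) (hV : ∀ x μ, V x μ ∈ specialUnitaryUnits (Fin N)) {η r : ℝ} (hη : 0 < η) (hr : 0 ≤ r)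
    (hG : letI : CStarAlgebra (MatA N) := {}; GaugedBoundB8 L η V c r)
    (hsmall : (2 * boxWidth (bLo L c.a c.k 0) (bHi L c.a c.M c.k 0) + 1) * (η * N * (r * ((L : ℝ) ^ c.k * η)⁻¹)) < 2 * Real.pi) :
    ∃ s : B7Prop1Explicit.Site d → Matrix.specialUnitaryGroup (Fin N) ℂ, ∃ A' : B7Prop1Explicit.Site d → Fin d → MatA N,
      (∀ x μ, x ∈ box L c.a c.M c.k → x + e μ ∈ box L c.a c.M c.k →
          B7Prop1Explicit.gaugeAct (fun y => ιSU N (s y)) V x μ = cfgExp η A' x μ) ∧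
      (∀ x μ, x ∈ box L c.a c.M c.k → x + e μ ∈ box L c.a c.M c.k → ‖A' x μ‖ ≤ 2 * (r * ((L : ℝ) ^ c.k * η)⁻¹)) ∧
      (∀ x μ ν, x ∈ box L c.a c.M c.k → x + e μ ∈ box L c.a c.M c.k → x + e ν ∈ box L c.a c.M c.k →
          ‖A' (x + e μ) ν - A' x ν‖ ≤ 2 * (η * r * (((L : ℝ) ^ c.k * η) ^ 2)⁻¹)) ∧
      (∀ x μ, x ∈ box L c.a c.M c.k → x + e μ ∈ box L c.a c.M c.k →
          (∀ ν, x + e ν ∈ box L c.a c.M c.k ∧ x - e ν ∈ box L c.a c.M c.k ∧ x - e ν + e μ ∈ box L c.a c.M c.k) →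
          ‖pdiv η (1 : B7Prop1Explicit.Site d → Fin d → (MatA N)ˣ) (plaqCovDeriv η 1 A') μ x‖ ≤ 2 * (r * (((L : ℝ) ^ c.k * η) ^ 3)⁻¹)) := by
  letI : CStarAlgebra (MatA N) := {}
  have hL1 : 1 ≤ L := le_trans (by norm_num) hL
  obtain ⟨u, hu, -, -, -, h162, hw, h135, h136₂, h136₃, -, -⟩ := hG
  set w : B7Prop1Explicit.Site d → (MatA N)ˣ := (c.vfix V)⁻¹ * u with hwdef
  set U₁ : B7Prop1Explicit.Site d → Fin d → (MatA N)ˣ := c.fixed V u with hU₁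
  have hg : ∀ x, InBox (bLo L c.a c.k 0) (bHi L c.a c.M c.k 0) x → w⁻¹ x ∈ unitaryUnits (MatA N) := fun x _ => by
    rw [Pi.inv_apply]; exact (unitaryUnits (MatA N)).inv_mem (hw x)
  have hboxT : box L c.a c.M c.k ⊆ tcube L c.a c.M c.ρ c.k := box_subset_tcube_of_le L c.a le_rfl c.ρ c.k
  have h136' : ∀ j, j ≤ c.k → ∀ b ∈ {b : B7Prop1Explicit.Site d × Fin d | SideTouches (c.sq j) b.1 b.2},
      ‖logCfg η U₁ b.1 b.2‖ ≤ r * ((L : ℝ) ^ j * η)⁻¹ := fun j hj b hb => (h162 j hj b hb).2.2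
  have hgauge : ∀ x μ, InBox (bLo L c.a c.k 0) (bHi L c.a c.M c.k 0) x → InBox (bLo L c.a c.k 0) (bHi L c.a c.M c.k 0) (x + e μ) →
      B7Prop1Explicit.gaugeAct w⁻¹ V x μ = cfgExp η (logCfg η U₁) x μ := by
    intro x μ hx hx'
    rw [h135 x μ (hboxT hx) (hboxT hx')]
    exact (h162 c.k le_rfl (x, μ) (sideTouches_sq_top_of_mem_box c hd hx μ)).1
  have hsa : ∀ x μ, InBox (bLo L c.a c.k 0) (bHi L c.a c.M c.k 0) x → InBox (bLo L c.a c.k 0) (bHi L c.a c.M c.k 0) (x + e μ) →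
      IsSelfAdjoint (logCfg η U₁ x μ) := fun x μ hx _ => (h162 c.k le_rfl (x, μ) (sideTouches_sq_top_of_mem_box c hd hx μ)).2.1
  have hA : ∀ x μ, InBox (bLo L c.a c.k 0) (bHi L c.a c.M c.k 0) x → InBox (bLo L c.a c.k 0) (bHi L c.a c.M c.k 0) (x + e μ) →
      ‖logCfg η U₁ x μ‖ ≤ r * ((L : ℝ) ^ c.k * η)⁻¹ := fun x μ hx _ => h136' c.k le_rfl (x, μ) (sideTouches_sq_top_of_mem_box c hd hx μ)
  have hVdet : ∀ x μ, InBox (bLo L c.a c.k 0) (bHi L c.a c.M c.k 0) x → InBox (bLo L c.a c.k 0) (bHi L c.a c.M c.k 0) (x + e μ) →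
      ((V x μ : (MatA N)ˣ) : MatA N).det = 1 := fun x μ _ _ => (Matrix.mem_specialUnitaryGroup_iff.1 (hV x μ)).2
  have hr₀ : 0 ≤ r * ((L : ℝ) ^ c.k * η)⁻¹ := mul_nonneg hr (inv_nonneg.2 (B8ScaledSupNorm.scale_pos hL1 hη c.k).le)
  obtain ⟨s, hs⟩ := exists_suGauge_of_unitaryGauge (bLo L c.a c.k 0) (bHi L c.a c.M c.k 0) hη.le V w⁻¹ (logCfg η U₁) hr₀ hVdet hg hgauge hsa hA hsmall
  refine ⟨s, fun y ν => traceless (logCfg η U₁ y ν), fun x μ hx hx' => hs x μ hx hx', fun x μ hx hx' => ?_, fun x μ ν hx hx' _ => ?_,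
    fun x μ hx hx' hν => ?_⟩
  · exact (norm_traceless_le _).trans (mul_le_mul_of_nonneg_left (hA x μ hx hx') (by norm_num))
  · exact (norm_traceless_sub_le _ _).trans
      (mul_le_mul_of_nonneg_left (norm_sub_le_of_msup_grad c hd hL1 hη hr U₁ h136' h136₂ hx hx') (by norm_num))
  · rw [pdiv_plaqCovDeriv_one_traceless]
    exact (norm_traceless_le _).trans (mul_le_mul_of_nonneg_left (norm_codiff_logCfg_le c hd hL1 hη hr U₁ h136' h136₃ hx hx' hν) (by norm_num))

end Assembly

end Literature.MathematicalPhysics.QuantumFieldTheory.Balaban1983to89.Node00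

end
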